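import Literature.Computation.Certificates.CliqueSumBlockLDL
import Literature.LinearAlgebra.Matrix.RectangularCongruenceInertia
import Literature.Analysis.Matrix.EigenvalueCountOnSubspaces
import HarnessLib

/-!
# Negative index of a clique sum: `i₋(Σ_c P_cᵀ S_c P_c) ≤ Σ_c i₋(S_c)` (subadditivity + congruence
# monotonicity of the inertia, Horn–Johnson Cor. 4.5.11 / Dym Thm 28.7), on the kernel object `blockSum bs`

Compute-infrastructure file (venture ladder GRIDFUSION, cell G2-SCALE, lead g19 TYPING ORDER object T4 «the inertia
wrapper #neg(blockSum bs) ≤ Σ_c #neg(S_c) on sos-5's kernel object `List (Block m ℚ)` / `blockSum bs`»; typed by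
gridfusion-lit-4 (g14), 2026-08-28).  Companion of `CliqueSumSparseCheck.lean` / `CliqueSumBlockLDL.lean`
(namespace `Literature.Computation.Certificates.PSD`): there ONE sweep decide identifies a target matrix `A` with the
clique sum `blockSum bs`, and PSD blocks give `A ⪰ 0`.  An INERTIA certificate (e.g. «the bordered matrix
`[H Σ; Σᵀ −δI]` has exactly two negative eigenvalues», the dVOC decrease condition of
`Literature/MathematicalPhysics/PowerSystems/DVOCDecreaseKernelForm.lean`) needs instead an UPPER BOUND ON THE
NUMBER OF NEGATIVE EIGENVALUES of `A`; this file derives it from the same object: the negative index is subadditive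
and does not increase under the (rectangular, possibly non-injective) clique congruence `S ↦ P_βᵀ S P_β`, so
`i₋(blockSum bs) ≤ Σ_{b ∈ bs} i₋(S_b)`; for a list `bsPos ++ negative rank-one terms` with `ldlAll bsPos` this is
`i₋(A) ≤ (number of negative terms)` — two decides and a short literal, no eigenvalue of any block computed.

## Contents (all PROVED; real symmetric matrices, rational kernel data cast to `ℝ`)
* §1 generic: `card_neg_eigenvalues_congr` (equal matrices, any Hermitian proofs), `card_neg_eigenvalues_add_le`
  (`i₋(A + B) ≤ i₋(A) + i₋(B)`: `A + B = [I I](A ⊕ B)[I I]ᵀ`), `embedAt_eq_mul_mul_transpose` (`embedAt idx S = C S Cᵀ`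
  with the 0/1 position matrix `C`), `card_neg_eigenvalues_embedAt_le` (`i₋(P_βᵀSP_β) ≤ i₋(S)`),
  `card_neg_eigenvalues_smul_vecMulVec_le_one` (`i₋(d·vvᵀ) ≤ 1`), `card_neg_eigenvalues_eq_zero_of_posSemidef`,
  `card_neg_eigenvalues_submatrix_equiv` (re-indexing by an equivalence keeps `i₋` — the glue between a kernel
  matrix on `Fin m` and a block-structured statement on `(Fin N ⊕ Fin N) ⊕ Fin 2`).
* §2 on the kernel object: `negIndex S` (the negative index of the real cast of a rational block, `:= k` for a
  non-symmetric `k × k` block), `isHermitian_blockSum_map`, **`card_neg_eigenvalues_blockSum_le`**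
  (`i₋((blockSum bs).map cast) ≤ (bs.map fun b => negIndex b.2).sum`).
* §3 kernel-facing: `outerBlock` (a scaled outer product `⟨members, d, v⟩ ↦ ⟨members, (d·v_i·v_j)⟩`),
  `negIndex_outerBlock_le_one`, `negIndex_eq_zero_of_ldlAll`, **`card_neg_eigenvalues_blockSum_append_le_length`**:
  `ldlAll bsPos = true ⇒ i₋((blockSum (bsPos ++ ts.map outerBlock)).map cast) ≤ ts.length`.
Sources: [cite: HornJohnson2013, Cor. 4.5.11 (inertia under a possibly singular congruence `i₊(SAS*) ≤ i₊(A)`,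
`i₋(SAS*) ≤ i₋(A)`) and 4.5.P21 (inertia of a direct sum)]; [cite: Dym2023, Thm 28.7] — both via the tree's
`Literature.LinearAlgebra.Matrix.RectangularCongruenceInertia`; the clique-sum frame
[cite: ZhengFantuzziPapachristodoulou2018, §3.2 Theorem 2].  0 named facts, 0 `sorry`, no instance, no notation.
-/

set_option linter.style.longLine false

namespace Literature.Computation.Certificates

namespace PSD

open Finset Matrix Literature.LinearAlgebra.Matrix

/-! ## §1 Generic negative-index lemmas (real symmetric) -/

section Generic

variable {n k : Type*} [Fintype n] [DecidableEq n] [Fintype k] [DecidableEq k]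

/-- Equal matrices have the same negative index (whatever the two symmetry proofs) — `i₋` is a function of the
matrix. [cite: HornJohnson2013, Cor. 4.5.11] (plumbing for its use) -/
theorem card_neg_eigenvalues_congr {A B : Matrix n n ℝ} (hA : A.IsHermitian) (hB : B.IsHermitian) (h : A = B) :
    #{i | hA.eigenvalues i < 0} = #{i | hB.eigenvalues i < 0} := by
  subst h; rfl

/-- **SUBADDITIVITY OF THE NEGATIVE INDEX**: `i₋(A + B) ≤ i₋(A) + i₋(B)` for real symmetric `A`, `B` — the
congruence `A + B = [I I] (A ⊕ B) [I I]ᵀ` by the `n × 2n` matrix `[I I]` and the inertia of a direct sum.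
[cite: HornJohnson2013, Cor. 4.5.11 with 4.5.P21]; [cite: Dym2023, Thm 28.7] -/
theorem card_neg_eigenvalues_add_le {A B : Matrix n n ℝ} (hA : A.IsHermitian) (hB : B.IsHermitian)
    (hAB : (A + B).IsHermitian) :
    #{i | hAB.eigenvalues i < 0} ≤ #{i | hA.eigenvalues i < 0} + #{i | hB.eigenvalues i < 0} := by
  have hD : (Matrix.fromBlocks A 0 0 B).IsHermitian :=
    Matrix.IsHermitian.fromBlocks hA (by simp) hB
  let C : Matrix n (n ⊕ n) ℝ := Matrix.fromCols 1 1
  have hC : C * Matrix.fromBlocks A 0 0 B * Cᴴ = A + B := by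
    rw [Matrix.fromCols_mul_fromBlocks, Matrix.conjTranspose_fromCols_eq_fromRows_conjTranspose,
      Matrix.fromCols_mul_fromRows]
    simp
  have hCH : (C * Matrix.fromBlocks A 0 0 B * Cᴴ).IsHermitian := by rw [hC]; exact hAB
  rw [← card_neg_eigenvalues_congr hCH hAB hC, ← card_eigenvalues_fromBlocks_zero_zero_eq_add hA hB hD
    (fun x => x < 0)]
  exact card_neg_eigenvalues_mul_mul_conjTranspose_le hD C hCH

/-- The 0/1 POSITION MATRIX of a clique position map: `C i a = 1` iff `idx i = some a`.
[cite: ZhengFantuzziPapachristodoulou2018, §3.2 ((E_𝒞)_{ij} = 1 iff 𝒞(i) = j)] -/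
def positionMatrix {m : ℕ} (idx : n → Option (Fin m)) : Matrix n (Fin m) ℝ :=
  Matrix.of fun i a => if idx i = some a then 1 else 0

omit [Fintype n] [DecidableEq n] in
/-- **`embedAt idx S = C S Cᵀ`** with `C` the position matrix (a rectangular, possibly non-injective congruence).
[cite: ZhengFantuzziPapachristodoulou2018, §3.2 (the inflation E_𝒞ᵀ Y E_𝒞)] -/
theorem embedAt_eq_mul_mul_transpose {m : ℕ} (idx : n → Option (Fin m)) (S : Matrix (Fin m) (Fin m) ℝ) :
    embedAt idx S = positionMatrix idx * S * (positionMatrix idx)ᵀ := by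
  ext i j
  simp only [embedAt, Matrix.of_apply, Matrix.mul_apply, Matrix.transpose_apply, positionMatrix]
  rcases hi : idx i with _ | a <;> rcases hj : idx j with _ | b
  · simp
  · simp
  · simp
  · simp only [Option.some.injEq, mul_ite, mul_one, mul_zero, ite_mul, one_mul, zero_mul]
    rw [Finset.sum_eq_single b (fun b' _ hb' => by rw [if_neg (Ne.symm hb')]) (by simp)]
    simp only [if_true]
    rw [Finset.sum_eq_single a (fun a' _ ha' => by rw [if_neg (Ne.symm ha')]) (by simp)]
    simp

/-- **THE NEGATIVE INDEX DOES NOT INCREASE UNDER CLIQUE EMBEDDING**: `i₋(P_βᵀ S P_β) ≤ i₋(S)`.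
[cite: HornJohnson2013, Cor. 4.5.11]; [cite: Dym2023, Thm 28.7] -/
theorem card_neg_eigenvalues_embedAt_le {m : ℕ} (idx : n → Option (Fin m)) {S : Matrix (Fin m) (Fin m) ℝ}
    (hS : S.IsHermitian) (hE : (embedAt idx S).IsHermitian) :
    #{i | hE.eigenvalues i < 0} ≤ #{i | hS.eigenvalues i < 0} := by
  have hC : positionMatrix idx * S * (positionMatrix idx)ᴴ = embedAt idx S := by
    rw [Matrix.conjTranspose_eq_transpose_of_trivial, ← embedAt_eq_mul_mul_transpose]
  have hCH : (positionMatrix idx * S * (positionMatrix idx)ᴴ).IsHermitian := by rw [hC]; exact hE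
  rw [← card_neg_eigenvalues_congr hCH hE hC]
  exact card_neg_eigenvalues_mul_mul_conjTranspose_le hS _ hCH

/-- **A SCALED OUTER PRODUCT HAS NEGATIVE INDEX ≤ 1**: `i₋(d·vvᵀ) ≤ 1` (`d·vvᵀ = v (d) vᵀ`, a congruence of the
`1 × 1` matrix `(d)`). [cite: HornJohnson2013, Cor. 4.5.11]; [cite: Dym2023, Thm 28.7] -/
theorem card_neg_eigenvalues_smul_vecMulVec_le_one (d : ℝ) (v : k → ℝ)
    (hM : (d • Matrix.vecMulVec v v).IsHermitian) : #{i | hM.eigenvalues i < 0} ≤ 1 := by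
  let C : Matrix k Unit ℝ := Matrix.of fun i _ => v i
  let D : Matrix Unit Unit ℝ := Matrix.of fun _ _ => d
  have hD : D.IsHermitian := by
    rw [Matrix.IsHermitian, Matrix.conjTranspose_eq_transpose_of_trivial]; ext; rfl
  have hC : C * D * Cᴴ = d • Matrix.vecMulVec v v := by
    ext i j
    simp [C, D, Matrix.mul_apply, Matrix.vecMulVec_apply, mul_comm, mul_left_comm]
  have hCH : (C * D * Cᴴ).IsHermitian := by rw [hC]; exact hM
  rw [← card_neg_eigenvalues_congr hCH hM hC]
  refine (card_neg_eigenvalues_mul_mul_conjTranspose_le hD C hCH).trans ?_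
  exact (Finset.card_le_univ _).trans (by simp)

/-- A positive semidefinite matrix has negative index `0`. [cite: HornJohnson2013, Cor. 4.5.11] (plumbing: the
eigenvalues of a PSD matrix are `≥ 0`) -/
theorem card_neg_eigenvalues_eq_zero_of_posSemidef {A : Matrix n n ℝ} (hA : A.PosSemidef) (hH : A.IsHermitian) :
    #{i | hH.eigenvalues i < 0} = 0 := by
  rw [Finset.card_eq_zero, Finset.filter_eq_empty_iff]
  intro i _
  exact not_lt.mpr (hA.eigenvalues_nonneg i)

/-- **THE NEGATIVE INDEX IS INVARIANT UNDER RE-INDEXING** (`A.submatrix e e` for an EQUIVALENCE `e` is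
permutation-similar to `A`): the inclusion principle both ways. [cite: HornJohnson2013, Theorem 4.3.28 (with
`m = n`: a permutation similarity) and Cor. 4.5.11] -/
theorem card_neg_eigenvalues_submatrix_equiv {A : Matrix n n ℝ} (hA : A.IsHermitian) (e : k ≃ n)
    (hS : (A.submatrix e e).IsHermitian) :
    #{i | hS.eigenvalues i < 0} = #{i | hA.eigenvalues i < 0} := by
  classical
  refine le_antisymm ?_ ?_
  · have h := Literature.Analysis.Matrix.EigenvalueCountOnSubspaces.card_submatrix_eigenvalues_lt_le hA
      e.injective 0
    rw [card_neg_eigenvalues_congr hS (hA.submatrix e) rfl]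
    simpa using h
  · have hback : (A.submatrix e e).submatrix e.symm e.symm = A := by
      rw [Matrix.submatrix_submatrix]; simp
    have hA' : ((A.submatrix e e).submatrix e.symm e.symm).IsHermitian := hS.submatrix e.symm
    have h := Literature.Analysis.Matrix.EigenvalueCountOnSubspaces.card_submatrix_eigenvalues_lt_le hS
      e.symm.injective 0
    rw [card_neg_eigenvalues_congr hA hA' hback.symm]
    simpa using h

end Generic

/-! ## §2 The negative index of a clique sum on the kernel object -/

variable {N : ℕ}

/-- THE NEGATIVE INDEX OF (the real cast of) A RATIONAL BLOCK — `#{i | λ_i(S) < 0}` when `S` is symmetric, and the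
trivial value `k` otherwise (a total function of the block). [cite: HornJohnson2013, Cor. 4.5.11] (the inertia
`(i₊, i₋, i₀)`; here `i₋` of a clique block [cite: ZhengFantuzziPapachristodoulou2018, §3.2]) -/
noncomputable def negIndex {k : ℕ} (S : Matrix (Fin k) (Fin k) ℚ) : ℕ :=
  if h : (S.map (Rat.cast : ℚ → ℝ)).IsHermitian then #{i | h.eigenvalues i < 0} else k

/-- For a symmetric block, `negIndex` is the negative eigenvalue count (any symmetry proof).
[cite: ZhengFantuzziPapachristodoulou2018, §3.2] (plumbing on the clique blocks) -/
theorem negIndex_eq {k : ℕ} {S : Matrix (Fin k) (Fin k) ℚ} (h : (S.map (Rat.cast : ℚ → ℝ)).IsHermitian) :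
    negIndex S = #{i | h.eigenvalues i < 0} := by
  rw [negIndex, dif_pos h]

/-- The negative eigenvalue count of a symmetric block is `≤ negIndex` (it IS `negIndex`).
[cite: ZhengFantuzziPapachristodoulou2018, §3.2] (plumbing on the clique blocks) -/
theorem card_neg_eigenvalues_le_negIndex {k : ℕ} (S : Matrix (Fin k) (Fin k) ℚ)
    (h : (S.map (Rat.cast : ℚ → ℝ)).IsHermitian) : #{i | h.eigenvalues i < 0} ≤ negIndex S := by
  rw [negIndex_eq h]

/-- The real cast of an embedded block is the embedding of the cast block. [cite: ZhengFantuzziPapachristodoulou2018, §3.2] -/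
theorem embed_map (b : Block N ℚ) :
    (b.embed).map (Rat.cast : ℚ → ℝ) = embedAt (listIdx b.1) (b.2.map (Rat.cast : ℚ → ℝ)) := by
  rw [Block.embed, embedAt_map _ _ (Rat.cast : ℚ → ℝ) Rat.cast_zero]

/-- An embedded symmetric block is symmetric. [cite: ZhengFantuzziPapachristodoulou2018, §3.2] -/
theorem isHermitian_embedAt_of {n : Type*} {k : ℕ} (idx : n → Option (Fin k)) {S : Matrix (Fin k) (Fin k) ℝ}
    (hS : S.IsHermitian) : (embedAt idx S).IsHermitian := by
  classical
  have : (embedAt idx S)ᵀ = embedAt idx S := by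
    ext i j
    simp only [Matrix.transpose_apply, embedAt, Matrix.of_apply]
    rcases idx i with _ | a <;> rcases idx j with _ | b <;> simp
    simpa using (hS.apply b a).symm
  rw [Matrix.IsHermitian, Matrix.conjTranspose_eq_transpose_of_trivial, this]

/-- **THE INERTIA WRAPPER**: for blocks whose real casts are symmetric,
`#{i | λ_i((blockSum bs).map cast) < 0} ≤ Σ_{b ∈ bs} negIndex b.2` — subadditivity down the list plus congruence
monotonicity per embedded block. [cite: HornJohnson2013, Cor. 4.5.11 with 4.5.P21]; [cite: Dym2023, Thm 28.7];
frame [cite: ZhengFantuzziPapachristodoulou2018, §3.2 Theorem 2] -/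
theorem card_neg_eigenvalues_blockSum_le (bs : List (Block N ℚ))
    (hbs : ∀ b ∈ bs, (b.2.map (Rat.cast : ℚ → ℝ)).IsHermitian)
    (hH : ((blockSum bs).map (Rat.cast : ℚ → ℝ)).IsHermitian) :
    #{i | hH.eigenvalues i < 0} ≤ (bs.map fun b => negIndex b.2).sum := by
  induction bs with
  | nil =>
    have h0 : ((blockSum ([] : List (Block N ℚ))).map (Rat.cast : ℚ → ℝ)) = 0 := by
      rw [blockSum_nil, Matrix.map_zero _ Rat.cast_zero]
    rw [List.map_nil, List.sum_nil, Nat.le_zero,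
      card_neg_eigenvalues_eq_zero_of_posSemidef (by rw [h0]; exact Matrix.PosSemidef.zero) hH]
  | cons b bs ih =>
    have hb : (b.2.map (Rat.cast : ℚ → ℝ)).IsHermitian := hbs b List.mem_cons_self
    have hbs' : ∀ b' ∈ bs, (b'.2.map (Rat.cast : ℚ → ℝ)).IsHermitian :=
      fun b' hb' => hbs b' (List.mem_cons_of_mem _ hb')
    have hE : ((b.embed).map (Rat.cast : ℚ → ℝ)).IsHermitian := by
      rw [embed_map]; exact isHermitian_embedAt_of _ hb
    -- the tail sum is symmetric: it is the (symmetric) whole minus the symmetric head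
    have hT : ((blockSum bs).map (Rat.cast : ℚ → ℝ)).IsHermitian := by
      have : (blockSum bs).map (Rat.cast : ℚ → ℝ)
          = (blockSum (b :: bs)).map (Rat.cast : ℚ → ℝ) - (b.embed).map (Rat.cast : ℚ → ℝ) := by
        rw [blockSum_cons, Matrix.map_add (Rat.cast : ℚ → ℝ) Rat.cast_add, add_sub_cancel_left]
      rw [this]; exact hH.sub hE
    have hsum : (blockSum (b :: bs)).map (Rat.cast : ℚ → ℝ)
        = (b.embed).map (Rat.cast : ℚ → ℝ) + (blockSum bs).map (Rat.cast : ℚ → ℝ) := by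
      rw [blockSum_cons, Matrix.map_add (Rat.cast : ℚ → ℝ) Rat.cast_add]
    have hAB : ((b.embed).map (Rat.cast : ℚ → ℝ) + (blockSum bs).map (Rat.cast : ℚ → ℝ)).IsHermitian := by
      rw [← hsum]; exact hH
    rw [card_neg_eigenvalues_congr hH hAB hsum, List.map_cons, List.sum_cons]
    refine (card_neg_eigenvalues_add_le hE hT hAB).trans (Nat.add_le_add ?_ (ih hbs' hT))
    have hE' : (embedAt (listIdx b.1) (b.2.map (Rat.cast : ℚ → ℝ))).IsHermitian := isHermitian_embedAt_of _ hb
    rw [card_neg_eigenvalues_congr hE hE' (embed_map b), negIndex_eq hb]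
    exact card_neg_eigenvalues_embedAt_le _ hb hE'

/-! ## §3 Kernel-facing form: PSD blocks by `ldlAll`, negative terms as scaled outer products -/

/-- A NEGATIVE (or any-sign) RANK-ONE TERM `d·ℓℓᵀ` of an exact elimination, supported on the member list
`members`: the block `⟨members, (d·ℓ_i·ℓ_j)_{ij}⟩`. [cite: ZhengFantuzziPapachristodoulou2018, §3.2] (one clique term) -/
def outerBlock (t : (m : List (Fin N)) × (ℚ × (Fin m.length → ℚ))) : Block N ℚ :=
  ⟨t.1, Matrix.of fun i j => t.2.1 * t.2.2 i * t.2.2 j⟩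

/-- The real cast of an outer block's matrix is `d • vecMulVec ℓ ℓ`. [cite: ZhengFantuzziPapachristodoulou2018, §3.2] (plumbing: one clique term) -/
theorem outerBlock_map (t : (m : List (Fin N)) × (ℚ × (Fin m.length → ℚ))) :
    (outerBlock t).2.map (Rat.cast : ℚ → ℝ)
      = (t.2.1 : ℝ) • Matrix.vecMulVec (fun i => (t.2.2 i : ℝ)) (fun i => (t.2.2 i : ℝ)) := by
  ext i j
  simp [outerBlock, Matrix.vecMulVec_apply, mul_assoc]

/-- An outer block is symmetric. [cite: ZhengFantuzziPapachristodoulou2018, §3.2] (plumbing: one clique term) -/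
theorem isHermitian_outerBlock_map (t : (m : List (Fin N)) × (ℚ × (Fin m.length → ℚ))) :
    ((outerBlock t).2.map (Rat.cast : ℚ → ℝ)).IsHermitian := by
  rw [Matrix.IsHermitian, Matrix.conjTranspose_eq_transpose_of_trivial]
  ext i j
  simp only [Matrix.transpose_apply, Matrix.map_apply, outerBlock, Matrix.of_apply]
  push_cast; ring

/-- **`negIndex (outerBlock t) ≤ 1`**. [cite: HornJohnson2013, Cor. 4.5.11]; [cite: Dym2023, Thm 28.7] -/
theorem negIndex_outerBlock_le_one (t : (m : List (Fin N)) × (ℚ × (Fin m.length → ℚ))) :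
    negIndex (outerBlock t).2 ≤ 1 := by
  have h := isHermitian_outerBlock_map t
  have h' : ((t.2.1 : ℝ) • Matrix.vecMulVec (fun i => (t.2.2 i : ℝ)) (fun i => (t.2.2 i : ℝ))).IsHermitian := by
    rw [← outerBlock_map]; exact h
  rw [negIndex_eq h, card_neg_eigenvalues_congr h h' (outerBlock_map t)]
  exact card_neg_eigenvalues_smul_vecMulVec_le_one _ _ h'

/-- **`ldlAll bs = true ⇒ negIndex b.2 = 0` for every `b ∈ bs`** (a PSD block has no negative eigenvalue).
[cite: BlekhermanParriloThomas2012, App. A.1.2] (soundness of the exact `LDLᵀ` self-certificate, via the tree) -/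
theorem negIndex_eq_zero_of_ldlAll {bs : List (Block N ℚ)} (h : ldlAll bs = true) {b : Block N ℚ} (hb : b ∈ bs) :
    negIndex b.2 = 0 := by
  have hpsd : (b.2.map (Rat.cast : ℚ → ℝ)).PosSemidef := forall_posSemidef_of_ldlAll h b hb
  rw [negIndex_eq hpsd.1]
  exact card_neg_eigenvalues_eq_zero_of_posSemidef hpsd hpsd.1

/-- **KERNEL-FACING INERTIA BOUND**: if the PSD part passes `ldlAll` and the remaining terms are scaled outer
products, then `#{i | λ_i((blockSum (bsPos ++ ts.map outerBlock)).map cast) < 0} ≤ ts.length` — with the sweep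
identity `A = blockSum (bsPos ++ ts.map outerBlock)` (one `cliqueSweepS` decide) this bounds the negative index of the
target `A` by the number of exported negative pivots, no eigenvalue of any block computed.
[cite: HornJohnson2013, Cor. 4.5.11 with 4.5.P21]; [cite: ZhengFantuzziPapachristodoulou2018, §3.2 Theorem 2] -/
theorem card_neg_eigenvalues_blockSum_append_le_length (bsPos : List (Block N ℚ)) (hldl : ldlAll bsPos = true)
    (ts : List ((m : List (Fin N)) × (ℚ × (Fin m.length → ℚ))))
    (hH : ((blockSum (bsPos ++ ts.map outerBlock)).map (Rat.cast : ℚ → ℝ)).IsHermitian) :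
    #{i | hH.eigenvalues i < 0} ≤ ts.length := by
  have hbs : ∀ b ∈ bsPos ++ ts.map outerBlock, (b.2.map (Rat.cast : ℚ → ℝ)).IsHermitian := by
    intro b hb
    rcases List.mem_append.mp hb with hb | hb
    · exact (forall_posSemidef_of_ldlAll (K := ℝ) hldl b hb).1
    · obtain ⟨t, _, rfl⟩ := List.mem_map.mp hb
      exact isHermitian_outerBlock_map t
  refine (card_neg_eigenvalues_blockSum_le _ hbs hH).trans ?_
  rw [List.map_append, List.sum_append, List.map_map]
  have h1 : (bsPos.map fun b => negIndex b.2).sum = 0 := by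
    refine List.sum_eq_zero fun x hx => ?_
    obtain ⟨b, hb, rfl⟩ := List.mem_map.mp hx
    exact negIndex_eq_zero_of_ldlAll hldl hb
  have h2 : (ts.map ((fun b : Block N ℚ => negIndex b.2) ∘ outerBlock)).sum ≤ ts.length := by
    have := List.sum_le_card_nsmul (ts.map ((fun b : Block N ℚ => negIndex b.2) ∘ outerBlock)) 1
      (fun x hx => by
        obtain ⟨t, _, rfl⟩ := List.mem_map.mp hx
        exact negIndex_outerBlock_le_one t)
    simpa using this
  rw [h1, zero_add]
  exact h2

end PSD

end Literature.Computation.Certificates
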